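import Summits.QuantumFields.BalabanUV.Beta.FP.WardPairRankObstruction
import Summits.QuantumFields.BalabanUV.Beta.FP.NestedStepLawTorusInstance
import Summits.QuantumFields.BalabanUV.Beta.FP.PeriodisedWardOrderZero
import Summits.QuantumFields.BalabanUV.Beta.FP.TorusGeneratorIntertwining
import Summits.QuantumFields.BalabanUV.Beta.GAN24.ScaleNesting

/-!
# `BalabanUV.Beta.FP.WardPairRankObstructionTorus` — road «FP» for binder row D1, ROUTE T: **THE OBSTRUCTION TO READING THE COLOUR-STRIPPED TABLES
# THROUGH THE UN-LIFTED TWO-SIDED WARD LETTERS, AT THE TORUS CALL's TYPES** (F-FP-18-2 (3)) — the reason the (STEP) door LIFTS COLOUR (δ: `D1BFx/ColourLift`)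
# or FIXES THE SLICE (α: R-FP-54); IT KILLS NO LANDED THEOREM.  With an ANTISYMMETRIC first-order form table (DISPLAYED hypothesis), the un-lifted pair
# `a1 ∧ a1t` of the torus call (p313662 ∕ Delta p316503 ∕ Rows p318378 ∕ (B) p320614 ∕ leaf-02 p321180 ∕ p321955) has NO witnesses along some live basis bond
# direction `δ_{b₀}` — by the rank count of `WardPairRankObstruction` §1, leaf-05's `torus_h1`, leaf-02's `torus_H₀_transpose` + ultralocal generator jet `W₁^{(h)}`

WHAT.  §1 `card_roots_le` (the small-comb roots of the fine box inject into the coarse box by `quo`), `card_deadBonds_le`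
(`#Dead ≤ (d+1)·|pbox M′|`), `tip_not_root_of_not_mem_deadBonds` (a bond off `Dead` tips at a fine residual parameter); §2 **`torus_exists_live_not_wardPair`**:
at the call's `hH₀ hQ₁₀ hτ₁` VERBATIM, for ANY `κ`-indexed composite averaging block `𝔔₀ : Matrix κ bonds ℝ`, ANY gauge-mode block `W₀`, under the
displayed cardinality inequality `hcard : |κ| + |(pbox M′ × Fin (d+1)) ⊕ Res| + (d+1)·|pbox M′| < |pbox (fine Lc M′) × Fin (d+1)|` (decidable per torus; with
`|κ| = (d+1)P∕Lc^{d+1}` it reads `d·Lc^{d+1} + 1 > 2(d+1) + (d+1)∕Lc^{d+1}`, true for all `d ≥ 1`, `Lc ≥ 2` — DISCHARGED in §3),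
THERE IS a bond `b₀` with `W₁ := W₁^{(δ b₀)}` (leaf-02's p318378 binder shape at the indicator direction) such that for EVERY antisymmetric `H₁`:
`¬ ∃ Y₁ Y′₁, (H₁ * W₀ + H₀ * W₁ = 𝔔₀ᵀ * Y₁) ∧ (H₁ᵀ * W₀ + H₀ᵀ * W₁ = 𝔔₀ᵀ * Y′₁)`; §3 THE COUNT IN CLOSED FORM: `card_pbox` (`|pbox M| = Π M_i`),
`card_pbox_fine`, `card_res_add_card_roots` (`|Res| + #roots = |pbox|`), `card_le_card_roots` (`y ↦ Lc•y + toSite r`: `|pbox M′| ≤ #roots`), `fine_div_eq`,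
`card_presentation_le` (the call's `hfμ′ hcoarse′` slots inject into `pbox (M′∕Lc) × Fin (d+1)` by `quo`), `count_core` (`(d+1) + 2(d+1)L + L² < (d+1)L² + L`
for `L ≥ 4`, `d ≥ 1`), **`hcard_holds`** (the displayed count, for every `d ≥ 1`, `Lc ≥ 2`, `Lc ∣ M′ᵢ`), and the corollary
**`torus_exists_live_not_wardPair_of_presentation`** — the same conclusion with NO cardinality hypothesis, at the call's own `hfμ′ hcoarse′`.

WHAT IT DOES NOT SAY: that the record's `H₁^{(h)}` IS antisymmetric (Q-FP-18-2, an2's); anything about the colour-doubled instance (F-FP-18-3 (δ): there the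
doubled odd jets are symmetric and `a1t = a1`) or the nested-slice reading (R-FP-54 (α)); it is the kernel form of «the UNDOUBLED `P`-sliced torus call is idle
beyond order 0 for antisymmetric first-order form tables».  [folklore] bookkeeping; no `def`, no `def … : Prop`, nothing cited, 0 sorry (the roots and
the dead bonds are spelled as explicit `Finset` expressions, no abbreviation introduced).

HONEST DEPENDENCY (page 1, mandatory): continuum YM on T⁴ ⇐ BetaPertH ∧ nine spine estimates (0/9 proved); BetaPertH ⇐ (D1) ∧ (D4) ∧ CAP+tail;
G-an2-4 gates asym, D1 and NE2/3/4.  HONEST FRAMING (cell contract, verbatim): «discharging `BetaPertH` makes Bałaban's UV stability UNCONDITIONAL —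
a real constructive-QFT result; it is NOT the continuum limit and NOT the Clay problem.»  ABSOLUTE RULE (cell charter, verbatim): «No internally-minted
statement may enter as a cited fact. Every hypothesis is either kernel-proved in this package or a verbatim quotation of a PUBLISHED theorem with page
reference. The manuscript(s) under audit are NOT citable for their own disputed steps — they are the thing under adjudication; programme-internal
(2001/route/tribunal) claims are never citable.»  0 estimates; 0∕4 row-D1 binders; NOT (T-ID), NOT SDF, NOT D1, NOT BetaPertH, NOT continuum, NOT Clay.
Road «FP», D1 formalisation swarm leaf-02 (b2b-balaban-beta-d1-formalise-leaf-02) gen 19, 2026-08-22 (OFFER O-d1leaf02g19-1 §2; OWNER GO + title, W-FP-18-8 (c)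
l.41213).  No existing file touched.
-/

noncomputable section

open scoped BigOperators

namespace Summit.QuantumFields.BalabanUV.Beta.FP.WardPairRankObstructionTorus

open Matrix Finset
open Literature.Probability.LatticeModels (Torus.proj)
open Literature.MathematicalPhysics.QuantumFieldTheory.Balaban1983to89
open Literature.MathematicalPhysics.QuantumFieldTheory.Balaban1983to89.Beta
open Literature.MathematicalPhysics.QuantumFieldTheory.Balaban1983to89.Beta.Composition (kkt)
open Literature.MathematicalPhysics.QuantumFieldTheory.LatticeForm (quo)
open B5Prop11Plancherel (fine)
open B6Lemma24Torus (pbox mem_pbox)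
open AffineAveraging (Site box toSite unitVec)
open OneStepResolventKernel (Fib)
open Summit.QuantumFields.BalabanUV.Beta.BorderedHessian (bhKStepAt stepScale)
open Summit.QuantumFields.BalabanUV.Beta.FP.KernelPeriodisationFib (Idx perF)
open Summit.QuantumFields.BalabanUV.Beta.FP.TorusGaugeCovariance (tdelta)
open Summit.QuantumFields.BalabanUV.Beta.FP.TorusGaugeCovariancePairing (wrapPt wrapPt_of_mem wrapPt_coe tdelta_eq_ite_wrapPt)
open Summit.QuantumFields.BalabanUV.Beta.FP.TorusGaugeCovarianceCoarse (coarsePt)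
open Summit.QuantumFields.BalabanUV.Beta.FP.TorusCombForest (rootOf)
open Summit.QuantumFields.BalabanUV.Beta.FP.TorusCombRows (Res combRowsT)
open Summit.QuantumFields.BalabanUV.Beta.FP.TorusCombNestedBasis (quo_mem_pbox)
open Summit.QuantumFields.BalabanUV.Beta.FP.TorusGeneratorIntertwining (rootOf_eq_smul_quo_add)
open Summit.QuantumFields.BalabanUV.Beta.FP.NestedStepLawTorusInstance (torus_h1)
open Summit.QuantumFields.BalabanUV.Beta.FP.PeriodisedWardOrderZero (torus_H₀_transpose)
open Summit.QuantumFields.BalabanUV.Beta.FP.WardPairRankObstruction (exists_live_not_wardPair)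
open Summit.QuantumFields.BalabanUV.Beta.GAN24.ScaleNesting (proj_eq_zero_iff)

variable {d : ℕ} (M' : Fin (d + 1) → ℕ) [∀ μ, NeZero (M' μ)] {Lc : ℕ} [NeZero Lc] {r : Fin (d + 1) → ℕ}

/-! ## §1 Roots and dead bonds: the counting side -/

omit [∀ μ, NeZero (M' μ)] in
/-- [folklore] **the roots of the fine box inject into the coarse box** (`y ↦ quo Lc y`; a root is `Lc • quo Lc y + ρ`), so `#roots ≤ |pbox M′|`. -/
theorem card_roots_le (ρ : Site (d + 1)) :
    (univ.filter fun y : ↥(pbox (fine Lc M')) => (y : Site (d + 1)) = rootOf ρ Lc (y : Site (d + 1))).card ≤ (pbox M').card := by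
  classical
  have hLc : 0 < Lc := Nat.pos_of_ne_zero (NeZero.ne Lc)
  refine Finset.card_le_card_of_injOn (fun y : ↥(pbox (fine Lc M')) => quo Lc (y : Site (d + 1))) (fun y _ => quo_mem_pbox hLc y.2) ?_
  intro y hy y' hy' h
  rw [Finset.mem_coe, Finset.mem_filter] at hy hy'
  apply Subtype.ext
  rw [hy.2, hy'.2, rootOf_eq_smul_quo_add, rootOf_eq_smul_quo_add]
  exact congrArg (fun q : Site (d + 1) => (Lc : ℤ) • q + ρ) h

/-- [folklore] **`#Dead ≤ (d+1)·|pbox M′|`** for the DEAD bonds — those whose tip is a small-comb root, presented as the image of `roots × directions`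
under `(y, l) ↦ (wrapPt (y − e_l), l)`. -/
theorem card_deadBonds_le (ρ : Site (d + 1)) :
    ((((univ.filter fun y : ↥(pbox (fine Lc M')) => (y : Site (d + 1)) = rootOf ρ Lc (y : Site (d + 1))) ×ˢ (univ : Finset (Fin (d + 1)))).image
      fun yl => (wrapPt (fine Lc M') ((yl.1 : Site (d + 1)) - unitVec yl.2), yl.2))).card ≤ (d + 1) * (pbox M').card := by
  classical
  refine Finset.card_image_le.trans ?_
  rw [Finset.card_product, Finset.card_univ, Fintype.card_fin, mul_comm]
  exact Nat.mul_le_mul_left _ (card_roots_le M' ρ)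

omit [NeZero Lc] in
/-- [folklore] **a bond off the dead set tips at a fine RESIDUAL parameter**: `wrapPt (b.1 + e_{b.2})` is not a small-comb root. -/
theorem tip_not_root_of_not_mem_deadBonds (ρ : Site (d + 1)) {M : Fin (d + 1) → ℕ} [∀ μ, NeZero (M μ)] {b : ↥(pbox M) × Fin (d + 1)}
    (hb : b ∉ (((univ.filter fun y : ↥(pbox M) => (y : Site (d + 1)) = rootOf ρ Lc (y : Site (d + 1))) ×ˢ (univ : Finset (Fin (d + 1)))).image
      fun yl => (wrapPt M ((yl.1 : Site (d + 1)) - unitVec yl.2), yl.2))) :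
    ((wrapPt M ((b.1 : Site (d + 1)) + unitVec b.2) : ↥(pbox M)) : Site (d + 1))
      ≠ rootOf ρ Lc ((wrapPt M ((b.1 : Site (d + 1)) + unitVec b.2) : ↥(pbox M)) : Site (d + 1)) := by
  classical
  intro hroot
  apply hb
  rw [Finset.mem_image]
  refine ⟨(wrapPt M ((b.1 : Site (d + 1)) + unitVec b.2), b.2), ?_, ?_⟩
  · rw [Finset.mem_product, Finset.mem_filter]
    exact ⟨⟨Finset.mem_univ _, hroot⟩, Finset.mem_univ _⟩
  · -- `wrapPt (wrapPt (b.1 + e) − e) = b.1`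
    obtain ⟨b1, l⟩ := b
    refine Prod.ext ?_ rfl
    apply Subtype.ext
    simp only [wrapPt_coe]
    rw [sub_eq_add_neg, B6Lemma24Torus.wrap_wrap_add, add_neg_cancel_right]
    exact B6Lemma24Torus.wrap_eq_self b1.2

/-! ## §2 The Ward pair at the torus call has no witnesses along some live basis bond -/

variable {r' : Fin (d + 1) → ℕ}

set_option synthInstance.maxSize 1024 in
/-- [folklore] **F-FP-18-2 (3) AT THE TORUS CALL's TYPES.**  At the call's `hH₀ hQ₁₀ hτ₁` (p313662 ∕ Delta ∕ (B) VERBATIM), for ANY composite averaging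
block `𝔔₀ : Matrix κ bonds ℝ` and ANY gauge-mode block `W₀`, under the displayed count `hcard`, there is a bond `b₀` such that, with leaf-02's generator first
jet ALONG THE INDICATOR DIRECTION `δ_{b₀}` (`hW₁`, p318378's shape at `h := [· = b₀]`), the two-sided first-order Ward pair has NO witnesses for ANY
antisymmetric first-order form table `H₁`:  `H₁ᵀ = −H₁ ⇒ ¬∃ Y₁ Y′₁, a1 ∧ a1t`.  Inputs BY NAME: leaf-05 `torus_h1` (bordered non-degeneracy), leaf-02
`torus_H₀_transpose`, `WardPairRankObstruction.exists_live_not_wardPair` (the rank count), §1 (dead bonds). -/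
theorem torus_exists_live_not_wardPair (hr : r ∈ box (d + 1) Lc) (j : ℕ) {κ : Type*} [Fintype κ] [DecidableEq κ]
    {H₀ : Matrix (↥(pbox (fine Lc M')) × Fin (d + 1)) (↥(pbox (fine Lc M')) × Fin (d + 1)) ℝ}
    {Q₁₀ : Matrix (↥(pbox M') × Fin (d + 1)) (↥(pbox (fine Lc M')) × Fin (d + 1)) ℝ}
    {τ₁ : Matrix (Res (toSite r) Lc (fine Lc M')) (↥(pbox (fine Lc M')) × Fin (d + 1)) ℝ}
    (hH₀ : H₀ = (perF (fine Lc M') (bhKStepAt d (toSite r) Lc j)).submatrix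
        (fun b : ↥(pbox (fine Lc M')) × Fin (d + 1) => ((b.1, Sum.inl b.2) : Idx (fine Lc M') (Fib d)))
        (fun b : ↥(pbox (fine Lc M')) × Fin (d + 1) => ((b.1, Sum.inl b.2) : Idx (fine Lc M') (Fib d))))
    (hQ₁₀ : Q₁₀ = (perF (fine Lc M') (bhKStepAt d (toSite r) Lc j)).submatrix
        (fun a : ↥(pbox M') × Fin (d + 1) => ((coarsePt M' Lc a.1, Sum.inr a.2) : Idx (fine Lc M') (Fib d)))
        (fun b : ↥(pbox (fine Lc M')) × Fin (d + 1) => ((b.1, Sum.inl b.2) : Idx (fine Lc M') (Fib d))))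
    (hτ₁ : τ₁ = (combRowsT (toSite r) Lc (fine Lc M')).submatrix id
        (fun b : ↥(pbox (fine Lc M')) × Fin (d + 1) => ((b.1, Sum.inl b.2) : Idx (fine Lc M') (Fib d))))
    -- the displayed cardinality count (decidable per torus; closed form: `d·Lc^{d+1} + 1 > 2(d+1) + (d+1)∕Lc^{d+1}` once `|κ| = (d+1)|pbox M′|∕Lc^{d+1}`)
    (hcard : Fintype.card κ + Fintype.card ((↥(pbox M') × Fin (d + 1)) ⊕ Res (toSite r) Lc (fine Lc M')) + (d + 1) * (pbox M').card
        < Fintype.card (↥(pbox (fine Lc M')) × Fin (d + 1)))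
    (𝔔₀ : Matrix κ (↥(pbox (fine Lc M')) × Fin (d + 1)) ℝ)
    (W₀ : Matrix (↥(pbox (fine Lc M')) × Fin (d + 1)) (Res (toSite r') Lc M' ⊕ Res (toSite r) Lc (fine Lc M')) ℝ) :
    ∃ b₀ : ↥(pbox (fine Lc M')) × Fin (d + 1), ∀ (H₁ : Matrix (↥(pbox (fine Lc M')) × Fin (d + 1)) (↥(pbox (fine Lc M')) × Fin (d + 1)) ℝ)
      {W₁ : Matrix (↥(pbox (fine Lc M')) × Fin (d + 1)) (Res (toSite r') Lc M' ⊕ Res (toSite r) Lc (fine Lc M')) ℝ},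
      -- leaf-02's generator first jet (p318378's `hW₁` shape) along the indicator direction `h := [· = b₀]`
      W₁ = ∑ b : ↥(pbox (fine Lc M')) × Fin (d + 1), (if b = b₀ then (1 : ℝ) else 0) •
        Matrix.of (fun (b' : ↥(pbox (fine Lc M')) × Fin (d + 1)) (e : Res (toSite r') Lc M' ⊕ Res (toSite r) Lc (fine Lc M')) =>
          if b' = b then
            -((((Lc : ℝ) ^ (d + 1) * stepScale d Lc j)⁻¹)
              * Sum.elim (fun t : Res (toSite r') Lc M' => tdelta M' (quo Lc ((b.1 : Site (d + 1)) + unitVec b.2)) t.1)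
                  (fun s : Res (toSite r) Lc (fine Lc M') => tdelta (fine Lc M') ((b.1 : Site (d + 1)) + unitVec b.2) s.1) e)
          else 0) →
      H₁ᵀ = -H₁ →
      ¬ ∃ Y₁ Y'₁ : Matrix κ (Res (toSite r') Lc M' ⊕ Res (toSite r) Lc (fine Lc M')) ℝ,
        H₁ * W₀ + H₀ * W₁ = 𝔔₀ᵀ * Y₁ ∧ H₁ᵀ * W₀ + H₀ᵀ * W₁ = 𝔔₀ᵀ * Y'₁ := by
  classical
  -- the bordered non-degeneracy and the symmetry of `H₀`, by name
  have hkkt : (kkt H₀ (fromRows Q₁₀ τ₁)).det ≠ 0 := by rw [hH₀, hQ₁₀, hτ₁]; exact torus_h1 M' hr j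
  have h0 : H₀ᵀ = H₀ := torus_H₀_transpose M' j hH₀
  -- the count, with the dead set bounded by `(d+1)·|pbox M′|`
  have hcard' : Fintype.card κ + Fintype.card ((↥(pbox M') × Fin (d + 1)) ⊕ Res (toSite r) Lc (fine Lc M'))
      + ((((univ.filter fun y : ↥(pbox (fine Lc M')) => (y : Site (d + 1)) = rootOf (toSite r) Lc (y : Site (d + 1))) ×ˢ (univ : Finset (Fin (d + 1)))).image
      fun yl => (wrapPt (fine Lc M') ((yl.1 : Site (d + 1)) - unitVec yl.2), yl.2))).card
      < Fintype.card (↥(pbox (fine Lc M')) × Fin (d + 1)) :=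
    lt_of_le_of_lt (Nat.add_le_add_left (card_deadBonds_le M' (toSite r)) _) hcard
  obtain ⟨b₀, hb₀, hmain⟩ := exists_live_not_wardPair (ρ := Res (toSite r') Lc M' ⊕ Res (toSite r) Lc (fine Lc M')) h0 hkkt 𝔔₀ _ hcard'
  refine ⟨b₀, fun H₁ W₁ hW₁ h1 => ?_⟩
  -- the fine residual parameter at the tip of `b₀`
  have htip := tip_not_root_of_not_mem_deadBonds (Lc := Lc) (toSite r) hb₀
  set s₀ : Res (toSite r) Lc (fine Lc M') := ⟨wrapPt (fine Lc M') ((b₀.1 : Site (d + 1)) + unitVec b₀.2), htip⟩ with hs₀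
  refine hmain H₁ W₀ W₁ (Sum.inr s₀) (-((((Lc : ℝ) ^ (d + 1) * stepScale d Lc j)⁻¹))) h1 ?_ ?_
  · -- `c ≠ 0`
    have hLc : (0 : ℝ) < (Lc : ℝ) := by exact_mod_cast Nat.pos_of_ne_zero (NeZero.ne Lc)
    exact neg_ne_zero.mpr (inv_ne_zero (mul_ne_zero (pow_ne_zero _ hLc.ne') (BorderedHessian.stepScale_ne_zero (d := d) (Lc := Lc) j)))
  · -- the column of `W₁^{(δ b₀)}` at `inr s₀` is `c·δ_{b₀}`
    intro a
    rw [hW₁, Matrix.sum_apply]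
    simp only [Matrix.smul_apply, Matrix.of_apply, Sum.elim_inr, smul_eq_mul, ite_mul, one_mul, zero_mul, Finset.sum_ite_eq',
      Finset.mem_univ, if_true]
    by_cases ha : a = b₀
    · simp only [if_pos ha, hs₀, tdelta_eq_ite_wrapPt, if_true, mul_one]
    · simp only [if_neg ha]

/-! ## §3 The count `hcard` in closed form: it holds on every torus (`d ≥ 1`, `Lc ≥ 2`, `Lc ∣ M′ᵢ`, sublattice presentation of the slots) -/

/-- [folklore] `|pbox M| = Π_i M_i`. -/
theorem card_pbox (M : Fin (d + 1) → ℕ) : (pbox M).card = ∏ i, M i := by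
  rw [pbox, Fintype.card_piFinset]
  refine Finset.prod_congr rfl fun i _ => ?_
  rw [Int.card_Ico, sub_zero, Int.toNat_natCast]

/-- [folklore] `|pbox (fine Lc M′)| = Lc^{d+1} · |pbox M′|`. -/
theorem card_pbox_fine (Lc : ℕ) (M' : Fin (d + 1) → ℕ) : (pbox (fine Lc M')).card = Lc ^ (d + 1) * (pbox M').card := by
  rw [card_pbox, card_pbox, Finset.prod_mul_distrib, Finset.prod_const, Finset.card_univ, Fintype.card_fin]

/-- [folklore] `|Res ρ N M| + #roots = |pbox M|` (the residual parameters are the non-roots). -/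
theorem card_res_add_card_roots (ρ : Site (d + 1)) (N : ℕ) (M : Fin (d + 1) → ℕ) :
    Fintype.card (Res ρ N M) + (univ.filter fun y : ↥(pbox M) => (y : Site (d + 1)) = rootOf ρ N (y : Site (d + 1))).card = (pbox M).card := by
  classical
  have hres : Fintype.card (Res ρ N M)
      = (univ.filter fun y : ↥(pbox M) => ¬ ((y : Site (d + 1)) = rootOf ρ N (y : Site (d + 1)))).card := by
    unfold Res
    exact Fintype.card_of_subtype _ fun y => by simp only [Finset.mem_filter, Finset.mem_univ, true_and, ne_eq]
  rw [hres, add_comm, Finset.card_filter_add_card_filter_not, Finset.card_univ, Fintype.card_coe]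

/-- [folklore] **every coarse box point gives a root** (`y ↦ Lc•y + toSite r`), so `|pbox M′| ≤ #roots` of the fine box. -/
theorem card_le_card_roots {Lc : ℕ} [NeZero Lc] {r : Fin (d + 1) → ℕ} (hr : r ∈ box (d + 1) Lc) (M' : Fin (d + 1) → ℕ) :
    (pbox M').card ≤ (univ.filter fun y : ↥(pbox (fine Lc M')) => (y : Site (d + 1)) = rootOf (toSite r) Lc (y : Site (d + 1))).card := by
  classical
  have hLc : 0 < Lc := Nat.pos_of_ne_zero (NeZero.ne Lc)
  have hLcz : (0 : ℤ) < (Lc : ℤ) := by exact_mod_cast hLc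
  have hri : ∀ i, (0 : ℤ) ≤ toSite r i ∧ toSite r i < (Lc : ℤ) := by
    intro i
    have h := Fintype.mem_piFinset.mp hr i
    rw [Finset.mem_range] at h
    exact ⟨by simp [toSite], by simp only [toSite]; exact_mod_cast h⟩
  -- the embedding `y ↦ Lc • y + toSite r` lands in the fine box
  have hmem : ∀ y : ↥(pbox M'), (fun i => (Lc : ℤ) * (y : Site (d + 1)) i + toSite r i) ∈ pbox (fine Lc M') := by
    intro y
    rw [mem_pbox]
    intro i
    have hy := (mem_pbox.mp y.2) i
    refine ⟨by nlinarith [(hri i).1, hy.1], ?_⟩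
    have : (y : Site (d + 1)) i + 1 ≤ (M' i : ℤ) := by omega
    calc (Lc : ℤ) * (y : Site (d + 1)) i + toSite r i < (Lc : ℤ) * (y : Site (d + 1)) i + Lc := by linarith [(hri i).2]
      _ = (Lc : ℤ) * ((y : Site (d + 1)) i + 1) := by ring
      _ ≤ (Lc : ℤ) * (M' i : ℤ) := by exact mul_le_mul_of_nonneg_left this hLcz.le
      _ = ((fine Lc M' i : ℕ) : ℤ) := by simp [fine, Nat.cast_mul]
  -- count through the injection into `univ`, landing in `roots`
  rw [← Fintype.card_coe (pbox M'), ← Finset.card_univ]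
  refine Finset.card_le_card_of_injOn (fun y : ↥(pbox M') => (⟨_, hmem y⟩ : ↥(pbox (fine Lc M')))) (fun y _ => ?_) ?_
  · -- it is a root: `rootOf ρ Lc (Lc•y + ρ) = Lc•y + ρ`
    rw [Finset.mem_coe, Finset.mem_filter]
    refine ⟨Finset.mem_univ _, ?_⟩
    funext i
    simp only [rootOf]
    have hq : ((Lc : ℤ) * (y : Site (d + 1)) i + toSite r i) / (Lc : ℤ) = (y : Site (d + 1)) i := by
      rw [add_comm, Int.add_mul_ediv_left _ _ hLcz.ne', Int.ediv_eq_zero_of_lt (hri i).1 (hri i).2, zero_add]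
    rw [hq]
  · intro y _ y' _ h
    apply Subtype.ext
    funext i
    have hi := congrFun (congrArg Subtype.val h) i
    simp only at hi
    exact mul_left_cancel₀ hLcz.ne' (add_right_cancel hi)

/-- [folklore] the coarse box with `Lc`-divisible sides is the fine box of `M″ := M′ ∕ Lc`. -/
theorem fine_div_eq {Lc : ℕ} {M' : Fin (d + 1) → ℕ} (hM' : ∀ i, Lc ∣ M' i) : fine Lc (fun i => M' i / Lc) = M' := by
  funext i
  exact Nat.mul_div_cancel' (hM' i)

/-- [folklore] **THE PRESENTED COARSE MULTIPLIER SLOTS ARE AT MOST `(d+1)·|pbox (M′∕Lc)|`**: an injective presentation whose range is the set of slots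
`(s, inr m)` with `proj Lc s = 0` injects into `pbox (M′∕Lc) × Fin (d+1)` by `a ↦ (quo Lc (pμ′ a), mμ′ a)`. -/
theorem card_presentation_le {Lc : ℕ} [NeZero Lc] {M' : Fin (d + 1) → ℕ} (hM' : ∀ i, Lc ∣ M' i) {κ : Type*} [Fintype κ]
    (pμ' : κ → ↥(pbox M')) (mμ' : κ → Fin (d + 1))
    (hfμ' : Function.Injective (fun a : κ => ((pμ' a, Sum.inr (mμ' a)) : Idx M' (Fib d))))
    (hcoarse' : ∀ (s : ↥(pbox M')) (m : Fin (d + 1)),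
      ((s, Sum.inr m) : Idx M' (Fib d)) ∈ Set.range (fun a : κ => ((pμ' a, Sum.inr (mμ' a)) : Idx M' (Fib d))) ↔ Torus.proj Lc (s : Site (d + 1)) = 0) :
    Fintype.card κ ≤ (d + 1) * (pbox (fun i => M' i / Lc)).card := by
  classical
  have hLc : 0 < Lc := Nat.pos_of_ne_zero (NeZero.ne Lc)
  have hfin := fine_div_eq hM'
  have hmem : ∀ a : κ, quo Lc ((pμ' a : ↥(pbox M')) : Site (d + 1)) ∈ pbox (fun i => M' i / Lc) := by
    intro a
    refine quo_mem_pbox hLc ?_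
    rw [hfin]
    exact (pμ' a).2
  -- every presented slot lies on the `Lc`-sublattice, hence is `Lc • quo` of itself
  have hdiv : ∀ a : κ, ∀ jx, (Lc : ℤ) ∣ ((pμ' a : ↥(pbox M')) : Site (d + 1)) jx := by
    intro a
    exact (proj_eq_zero_iff Lc _).mp ((hcoarse' (pμ' a) (mμ' a)).mp ⟨a, rfl⟩)
  let g : κ → ↥(pbox (fun i => M' i / Lc)) × Fin (d + 1) := fun a => (⟨_, hmem a⟩, mμ' a)
  have hg : Function.Injective g := by
    intro a b h
    have h1 : quo Lc ((pμ' a : ↥(pbox M')) : Site (d + 1)) = quo Lc ((pμ' b : ↥(pbox M')) : Site (d + 1)) :=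
      congrArg Subtype.val (congrArg Prod.fst h)
    have h2 : mμ' a = mμ' b := congrArg Prod.snd h
    have h3 : pμ' a = pμ' b := by
      apply Subtype.ext
      funext jx
      have hq := congrFun h1 jx
      simp only [quo] at hq
      rw [← Int.mul_ediv_cancel' (hdiv a jx), ← Int.mul_ediv_cancel' (hdiv b jx), hq]
    apply hfμ'
    simp only [h3, h2]
  calc Fintype.card κ ≤ Fintype.card (↥(pbox (fun i => M' i / Lc)) × Fin (d + 1)) := Fintype.card_le_of_injective g hg
    _ = (d + 1) * (pbox (fun i => M' i / Lc)).card := by rw [Fintype.card_prod, Fintype.card_coe, Fintype.card_fin, mul_comm]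

/-- [folklore] the arithmetic core: for `L ≥ 4`, `d ≥ 1`: `(d+1) + 2(d+1)L + L² < (d+1)L² + L`. -/
theorem count_core {d L : ℕ} (hd : 1 ≤ d) (hL : 4 ≤ L) : (d + 1) + 2 * (d + 1) * L + L * L < (d + 1) * (L * L) + L := by
  have h1 : d * L * 4 ≤ d * L * L := Nat.mul_le_mul_left (d * L) hL
  have h2 : d * 4 ≤ d * L := Nat.mul_le_mul_left d hL
  have h3 : L ≤ d * L := Nat.le_mul_of_pos_left L hd
  nlinarith

/-- [folklore] **THE DISPLAYED COUNT `hcard` OF `torus_exists_live_not_wardPair` HOLDS ON EVERY TORUS** (`d ≥ 1`, `Lc ≥ 2`, `Lc ∣ M′ᵢ`, an injective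
presentation of the coarse multiplier slots with the sublattice range). -/
theorem hcard_holds (hd : 1 ≤ d) {Lc : ℕ} [NeZero Lc] (hLc2 : 2 ≤ Lc) {M' : Fin (d + 1) → ℕ} [∀ μ, NeZero (M' μ)] (hM' : ∀ i, Lc ∣ M' i)
    {r : Fin (d + 1) → ℕ} (hr : r ∈ box (d + 1) Lc) {κ : Type*} [Fintype κ]
    (pμ' : κ → ↥(pbox M')) (mμ' : κ → Fin (d + 1))
    (hfμ' : Function.Injective (fun a : κ => ((pμ' a, Sum.inr (mμ' a)) : Idx M' (Fib d))))
    (hcoarse' : ∀ (s : ↥(pbox M')) (m : Fin (d + 1)),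
      ((s, Sum.inr m) : Idx M' (Fib d)) ∈ Set.range (fun a : κ => ((pμ' a, Sum.inr (mμ' a)) : Idx M' (Fib d))) ↔ Torus.proj Lc (s : Site (d + 1)) = 0) :
    Fintype.card κ + Fintype.card ((↥(pbox M') × Fin (d + 1)) ⊕ Res (toSite r) Lc (fine Lc M')) + (d + 1) * (pbox M').card
      < Fintype.card (↥(pbox (fine Lc M')) × Fin (d + 1)) := by
  classical
  have hLc : 0 < Lc := Nat.pos_of_ne_zero (NeZero.ne Lc)
  set L : ℕ := Lc ^ (d + 1) with hLdef
  set P : ℕ := (pbox (fun i => M' i / Lc)).card with hPdef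
  -- `L ≥ 4`
  have hL : 4 ≤ L := by
    calc 4 = 2 ^ 2 := by norm_num
      _ ≤ Lc ^ 2 := Nat.pow_le_pow_left hLc2 2
      _ ≤ Lc ^ (d + 1) := Nat.pow_le_pow_right hLc (by omega)
  -- `P ≥ 1` (the box `M′∕Lc` is nonempty)
  have hP : 1 ≤ P := by
    rw [hPdef, Nat.one_le_iff_ne_zero, ← Nat.pos_iff_ne_zero, card_pbox]
    exact Finset.prod_pos fun i _ => Nat.div_pos (Nat.le_of_dvd (Nat.pos_of_ne_zero (NeZero.ne (M' i))) (hM' i)) hLc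
  -- the four counts
  have hfin := fine_div_eq hM'
  have hM'card : (pbox M').card = L * P := by rw [← hfin, card_pbox_fine]
  have hfine : (pbox (fine Lc M')).card = L * (L * P) := by rw [card_pbox_fine, hM'card]
  have hκ : Fintype.card κ ≤ (d + 1) * P := card_presentation_le hM' pμ' mμ' hfμ' hcoarse'
  have hres : Fintype.card (Res (toSite r) Lc (fine Lc M')) + L * P ≤ L * (L * P) := by
    have h := card_res_add_card_roots (toSite r) Lc (fine Lc M')
    have h' := card_le_card_roots hr M'
    rw [hfine] at h
    rw [hM'card] at h'
    omega
  have hA : Fintype.card ((↥(pbox M') × Fin (d + 1)) ⊕ Res (toSite r) Lc (fine Lc M'))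
      = (d + 1) * (L * P) + Fintype.card (Res (toSite r) Lc (fine Lc M')) := by
    rw [Fintype.card_sum, Fintype.card_prod, Fintype.card_coe, Fintype.card_fin, hM'card, mul_comm]
  have hν : Fintype.card (↥(pbox (fine Lc M')) × Fin (d + 1)) = (d + 1) * (L * (L * P)) := by
    rw [Fintype.card_prod, Fintype.card_coe, Fintype.card_fin, hfine, mul_comm]
  rw [hA, hν, hM'card]
  have hcore := count_core hd hL
  have hcoreP : P * ((d + 1) + 2 * (d + 1) * L + L * L) < P * ((d + 1) * (L * L) + L) := Nat.mul_lt_mul_of_pos_left hcore hP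
  nlinarith

set_option synthInstance.maxSize 1024 in
/-- [folklore] **F-FP-18-2 (3) AT THE TORUS, WITH THE COUNT DISCHARGED**: for `d ≥ 1`, `Lc ≥ 2`, `Lc ∣ M′ᵢ` and the level-`(j+1)` multiplier slots presented
injectively with the sublattice range (the call's own `hfμ′ hcoarse′`), the conclusion of `torus_exists_live_not_wardPair` holds with NO cardinality
hypothesis: some live basis bond `b₀` along which, for EVERY antisymmetric first-order form table, the un-lifted pair `a1 ∧ a1t` has no witnesses. -/
theorem torus_exists_live_not_wardPair_of_presentation (hd : 1 ≤ d) (hLc2 : 2 ≤ Lc) (hM' : ∀ i, Lc ∣ M' i) (hr : r ∈ box (d + 1) Lc) (j : ℕ)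
    {κ : Type*} [Fintype κ] [DecidableEq κ] (pμ' : κ → ↥(pbox M')) (mμ' : κ → Fin (d + 1))
    (hfμ' : Function.Injective (fun a : κ => ((pμ' a, Sum.inr (mμ' a)) : Idx M' (Fib d))))
    (hcoarse' : ∀ (s : ↥(pbox M')) (m : Fin (d + 1)),
      ((s, Sum.inr m) : Idx M' (Fib d)) ∈ Set.range (fun a : κ => ((pμ' a, Sum.inr (mμ' a)) : Idx M' (Fib d))) ↔ Torus.proj Lc (s : Site (d + 1)) = 0)
    {H₀ : Matrix (↥(pbox (fine Lc M')) × Fin (d + 1)) (↥(pbox (fine Lc M')) × Fin (d + 1)) ℝ}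
    {Q₁₀ : Matrix (↥(pbox M') × Fin (d + 1)) (↥(pbox (fine Lc M')) × Fin (d + 1)) ℝ}
    {τ₁ : Matrix (Res (toSite r) Lc (fine Lc M')) (↥(pbox (fine Lc M')) × Fin (d + 1)) ℝ}
    (hH₀ : H₀ = (perF (fine Lc M') (bhKStepAt d (toSite r) Lc j)).submatrix
        (fun b : ↥(pbox (fine Lc M')) × Fin (d + 1) => ((b.1, Sum.inl b.2) : Idx (fine Lc M') (Fib d)))
        (fun b : ↥(pbox (fine Lc M')) × Fin (d + 1) => ((b.1, Sum.inl b.2) : Idx (fine Lc M') (Fib d))))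
    (hQ₁₀ : Q₁₀ = (perF (fine Lc M') (bhKStepAt d (toSite r) Lc j)).submatrix
        (fun a : ↥(pbox M') × Fin (d + 1) => ((coarsePt M' Lc a.1, Sum.inr a.2) : Idx (fine Lc M') (Fib d)))
        (fun b : ↥(pbox (fine Lc M')) × Fin (d + 1) => ((b.1, Sum.inl b.2) : Idx (fine Lc M') (Fib d))))
    (hτ₁ : τ₁ = (combRowsT (toSite r) Lc (fine Lc M')).submatrix id
        (fun b : ↥(pbox (fine Lc M')) × Fin (d + 1) => ((b.1, Sum.inl b.2) : Idx (fine Lc M') (Fib d))))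
    (𝔔₀ : Matrix κ (↥(pbox (fine Lc M')) × Fin (d + 1)) ℝ)
    (W₀ : Matrix (↥(pbox (fine Lc M')) × Fin (d + 1)) (Res (toSite r') Lc M' ⊕ Res (toSite r) Lc (fine Lc M')) ℝ) :
    ∃ b₀ : ↥(pbox (fine Lc M')) × Fin (d + 1), ∀ (H₁ : Matrix (↥(pbox (fine Lc M')) × Fin (d + 1)) (↥(pbox (fine Lc M')) × Fin (d + 1)) ℝ)
      {W₁ : Matrix (↥(pbox (fine Lc M')) × Fin (d + 1)) (Res (toSite r') Lc M' ⊕ Res (toSite r) Lc (fine Lc M')) ℝ},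
      W₁ = ∑ b : ↥(pbox (fine Lc M')) × Fin (d + 1), (if b = b₀ then (1 : ℝ) else 0) •
        Matrix.of (fun (b' : ↥(pbox (fine Lc M')) × Fin (d + 1)) (e : Res (toSite r') Lc M' ⊕ Res (toSite r) Lc (fine Lc M')) =>
          if b' = b then
            -((((Lc : ℝ) ^ (d + 1) * stepScale d Lc j)⁻¹)
              * Sum.elim (fun t : Res (toSite r') Lc M' => tdelta M' (quo Lc ((b.1 : Site (d + 1)) + unitVec b.2)) t.1)
                  (fun s : Res (toSite r) Lc (fine Lc M') => tdelta (fine Lc M') ((b.1 : Site (d + 1)) + unitVec b.2) s.1) e)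
          else 0) →
      H₁ᵀ = -H₁ →
      ¬ ∃ Y₁ Y'₁ : Matrix κ (Res (toSite r') Lc M' ⊕ Res (toSite r) Lc (fine Lc M')) ℝ,
        H₁ * W₀ + H₀ * W₁ = 𝔔₀ᵀ * Y₁ ∧ H₁ᵀ * W₀ + H₀ᵀ * W₁ = 𝔔₀ᵀ * Y'₁ :=
  torus_exists_live_not_wardPair M' hr j hH₀ hQ₁₀ hτ₁ (hcard_holds hd hLc2 hM' hr pμ' mμ' hfμ' hcoarse') 𝔔₀ W₀

end Summit.QuantumFields.BalabanUV.Beta.FP.WardPairRankObstructionTorus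

end
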